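import Literature.Probability.LatticeModels.LatticeLaplacian
import HarnessLib

/-!
# The phantom-weighted Laplacian of Duminil-Copin–Hongler–Nolin: comparison principle and the distance bound (DCHN Lemma 11, first item)

Topic `Literature/Probability/LatticeModels`; discrete potential theory for the Russo–Seymour–Welsh
programme for the critical FK-Ising model (named fact `fkIsing_rsw`, `FKIsingRSW.lean`) after
H. Duminil-Copin, C. Hongler, P. Nolin, *Connection probabilities and RSW-type bounds for the
two-dimensional FK Ising model*, Comm. Pure Appl. Math. 64 (2011), arXiv:0912.4253 (DCHN), §3.
Everything here is PROVED; no named fact, no FK object: statements about real functions on `ℤ²`.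

DCHN §3.1 (Proposition 8 and eq. (modified_laplacian); in the tree
`FKPrimitiveBoundaryLaplacian.phantom_laplacian_hw / _hb`) shows that the discrete primitive of
the fermionic observable is a sub/super-solution of a nearest-neighbour operator with weight `1`
towards ordinary neighbours and weight `w = 1 - tan²(π/8) = 2(√2 - 1)` towards the *phantom*
neighbours across the free arc, whose value is the arc level. In a slit domain `R ∖ γ[0,T]`
(DCHN §4) phantom directions occur along the explored interface in every orientation, so we work
with an **arbitrary assignment of phantom directions** `P : ℤ² → Finset (Fin 4)` and a phantom
level `β`:

  `L_{P,β} f (v) = ∑_{k ∉ P v} (f(v + e_k) - f v) + w · |P v| · (β - f v)`      (`phantomLaplacian`).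

* `phantomWeight = 1 - (√2-1)²`, `phantomWeight_eq` (`= 2√2 - 2`), `3/4 ≤ w < 1`.
* `phantomLaplacian_eq_latticeLaplacian_add` (`L_{P,β} f = Δ f + ∑_{k∈P} ((1-w) f + w β - f(·+e_k))`),
  `phantomLaplacian_sub` (differences solve the `β = 0` equation).
* **Maximum principle with killing** `phantom_le_of_forall_boundary_le`: on a finite `S`, if
  `L_{P,0} g ≥ 0` on `S` and `g ≤ M`, `M ≥ 0`, on the *non-phantom outer boundary*
  `phantomOuterBoundary P S = {v + e_k ∉ S : v ∈ S, k ∉ P v}`, then `g ≤ M` on `S`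
  (DCHN's harmonic-measure comparison, proof of Proposition 8; Lawler–Limic 2010 §6.1); the
  **comparison principle** `phantom_le_of_sub_super` (sub ≤ super given the inequality on the
  non-phantom outer boundary) and the robust criteria `phantomLaplacian_nonpos_of` /
  `phantomLaplacian_nonneg_of`: a lattice-superharmonic `v` with `v(x + e_k) ≥ (1-w) v(x) + w β`
  in the phantom directions is an `L_{P,β}`-supersolution, whatever `P` is.
* **DCHN Lemma 11, first item** (`Hb(B_0) ≤ c₃/d₁(0)`: the harmonic measure of the wired arc seen
  from a free-arc point at distance `d` from it is `O(1/d)`), as an explicit-barrier statement,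
  `phantom_sub_le_distBarrier` / **`dchn_lemma11_dist`**: let `z ∈ ℤ²`, `d ≥ 1`, `S` finite with
  `S ⊆ {Y ≥ 0, |X| + Y ≤ d - 1}` in coordinates `(X, Y) = v - z`, `u` an `L_{P,0}`-subsolution on
  `S` (any `P`) such that every non-phantom outer-boundary point `x` has `u x ≤ 0`, or `u x ≤ 1`
  and `|X| + Y = d`; then `u ≤ b` on `S` for the barrier
  `b = (X² - Y² + 2d(Y + 2))/(d² + 4d)` (`distBarrier`; lattice-harmonic, `= 1` on the `ℓ¹`-sphere
  of radius `d`, nonnegative, and `b(x') ≥ (1-w) b(x)` across every lattice edge from `S`, which is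
  where `w ≥ 3/4` enters), in particular **`u z ≤ 4/(d + 4)`**. For the primitive of a Dobrushin
  domain lying above the row of `z` whose wired arc is at `ℓ¹`-distance `≥ d` from `z` this is
  DCHN's bound with `c₃ = 4` (they do not compute the constant: "this harmonic measure is easy to
  estimate").

## References

* H. Duminil-Copin, C. Hongler, P. Nolin, *Connection probabilities and RSW-type bounds for the
  two-dimensional FK Ising model*, Comm. Pure Appl. Math. 64 (2011) 1165–1198, §3.1
  (Proposition 8, eq. (modified_laplacian)) and §3.2 (Lemma 11) — bib key
  `DuminilCopinHonglerNolin2011`.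
* G. Lawler, V. Limic, *Random Walk: A Modern Introduction* (2010), §6.1–6.2 (maximum principle,
  harmonic measure) — bib key `LawlerLimic2010`.
-/

noncomputable section

namespace Literature.Probability.LatticeModels

open Finset

/-! ### The phantom weight `w = 1 - tan²(π/8) = 2(√2 - 1)` -/

/-- DCHN's **phantom weight** `w = 1 - tan²(π/8) = 1 - (√2 - 1)²`: the relative rate of the
modified random walks `X_•`, `X_∘` towards the extra layer of faces along the boundary arc
(DCHN 2011, §3.1, eq. (modified_laplacian): weights `(2+√2)/(6+5√2)` and `2√2/(6+5√2)`, ratio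
`2√2/(2+√2) = 2(√2-1)`). [cite: DuminilCopinHonglerNolin2011, §3.1, eq. (modified_laplacian)] -/
def phantomWeight : ℝ := 1 - (Real.sqrt 2 - 1) ^ 2

/-- `w = 2√2 - 2`. [cite: DuminilCopinHonglerNolin2011, §3.1] -/
theorem phantomWeight_eq : phantomWeight = 2 * Real.sqrt 2 - 2 := by
  rw [phantomWeight, sub_sq, Real.sq_sqrt (by norm_num : (0 : ℝ) ≤ 2)]
  ring

/-- `3/4 ≤ w` (indeed `w ≈ 0.828`; from `√2 > 7/5`). [folklore] -/
theorem three_quarters_le_phantomWeight : 3 / 4 ≤ phantomWeight := by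
  have h : (7 / 5 : ℝ) < Real.sqrt 2 := by
    rw [Real.lt_sqrt (by norm_num)]
    norm_num
  rw [phantomWeight_eq]
  linarith

/-- `0 < w`. [folklore] -/
theorem phantomWeight_pos : 0 < phantomWeight :=
  lt_of_lt_of_le (by norm_num) three_quarters_le_phantomWeight

/-- `w < 1` (from `√2 < 3/2`). [folklore] -/
theorem phantomWeight_lt_one : phantomWeight < 1 := by
  have h : Real.sqrt 2 < 3 / 2 := by
    rw [Real.sqrt_lt' (by norm_num)]
    norm_num
  rw [phantomWeight_eq]
  linarith

/-- `0 ≤ 1 - w` (`1 - w = tan²(π/8)`). [folklore] -/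
theorem one_sub_phantomWeight_nonneg : 0 ≤ 1 - phantomWeight := by
  linarith [phantomWeight_lt_one]

/-- `1 - w ≤ 1/4`. [folklore] -/
theorem one_sub_phantomWeight_le : 1 - phantomWeight ≤ 1 / 4 := by
  linarith [three_quarters_le_phantomWeight]

/-! ### The phantom Laplacian -/

/-- The **phantom Laplacian** with phantom directions `P` and phantom level `β`:
`L_{P,β} f (v) = ∑_{k ∉ P v} (f(v + e_k) - f v) + w · |P v| · (β - f v)` — the ordinary
nearest-neighbour Laplacian in the non-phantom directions plus, for each phantom direction, a pull
of weight `w` towards the level `β` (DCHN 2011, eq. (modified_laplacian), with `H(B_S) = β` the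
value on the extra layer; `FKPrimitiveBoundaryLaplacian.phantom_laplacian_hw` is
`L_{P,H_B} Hw ≤ 0` at the sites next to the free arc).
[cite: DuminilCopinHonglerNolin2011, §3.1, eq. (modified_laplacian)] -/
def phantomLaplacian (P : Site 2 → Finset (Fin 4)) (β : ℝ) (f : Site 2 → ℝ) (v : Site 2) : ℝ :=
  (∑ k ∈ univ.filter (fun k => k ∉ P v), (f (v + cornerUnit k) - f v)) +
    phantomWeight * ((P v).card : ℝ) * (β - f v)

variable {P : Site 2 → Finset (Fin 4)}

/-- `L_{P,β} f (v) = Δ f (v) + ∑_{k ∈ P v} ((1 - w) f v + w β - f (v + e_k))`: the phantom Laplacian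
is the lattice Laplacian corrected in the phantom directions. [folklore] -/
theorem phantomLaplacian_eq_latticeLaplacian_add (β : ℝ) (f : Site 2 → ℝ) (v : Site 2) :
    phantomLaplacian P β f v = latticeLaplacian f v +
      ∑ k ∈ P v, ((1 - phantomWeight) * f v + phantomWeight * β - f (v + cornerUnit k)) := by
  have hsplit := Finset.sum_filter_add_sum_filter_not (univ : Finset (Fin 4)) (fun k => k ∈ P v)
    (fun k => f (v + cornerUnit k) - f v)
  have hmem : univ.filter (fun k => k ∈ P v) = P v := by
    ext k; simp
  rw [hmem] at hsplit
  rw [phantomLaplacian, latticeLaplacian, ← hsplit]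
  have hconst : ∑ k ∈ P v, ((1 - phantomWeight) * f v + phantomWeight * β - f (v + cornerUnit k)) =
      ∑ k ∈ P v, (phantomWeight * (β - f v)) - ∑ k ∈ P v, (f (v + cornerUnit k) - f v) := by
    rw [← Finset.sum_sub_distrib]
    refine Finset.sum_congr rfl fun k _ => ?_
    ring
  rw [hconst, Finset.sum_const, nsmul_eq_mul]
  ring

/-- With no phantom direction at `v` the phantom Laplacian is the lattice Laplacian. [folklore] -/
theorem phantomLaplacian_of_eq_empty (β : ℝ) (f : Site 2 → ℝ) {v : Site 2} (hv : P v = ∅) :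
    phantomLaplacian P β f v = latticeLaplacian f v := by
  rw [phantomLaplacian_eq_latticeLaplacian_add, hv, Finset.sum_empty, add_zero]

/-- **Differences solve the homogeneous equation**: `L_{P,β} f - L_{P,β} g = L_{P,0} (f - g)`. [folklore] -/
theorem phantomLaplacian_sub (β : ℝ) (f g : Site 2 → ℝ) (v : Site 2) :
    phantomLaplacian P β f v - phantomLaplacian P β g v = phantomLaplacian P 0 (f - g) v := by
  unfold phantomLaplacian
  have hs : ∑ k ∈ univ.filter (fun k => k ∉ P v), ((f - g) (v + cornerUnit k) - (f - g) v) =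
      ∑ k ∈ univ.filter (fun k => k ∉ P v), (f (v + cornerUnit k) - f v) -
        ∑ k ∈ univ.filter (fun k => k ∉ P v), (g (v + cornerUnit k) - g v) := by
    rw [← Finset.sum_sub_distrib]
    refine Finset.sum_congr rfl fun k _ => ?_
    simp only [Pi.sub_apply]
    ring
  rw [hs]
  simp only [Pi.sub_apply]
  ring

/-- **Supersolution criterion.** If `Δ v (x) ≤ 0` and `v (x + e_k) ≥ (1 - w) v x + w β` in every
phantom direction `k ∈ P x`, then `L_{P,β} v (x) ≤ 0` — whatever the other phantom data are. This is
how explicit lattice-superharmonic barriers are used in slit domains, where the phantom directions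
along the explored interface are not known in advance. [folklore] -/
theorem phantomLaplacian_nonpos_of {β : ℝ} {v : Site 2 → ℝ} {x : Site 2} (hΔ : latticeLaplacian v x ≤ 0)
    (hph : ∀ k ∈ P x, (1 - phantomWeight) * v x + phantomWeight * β ≤ v (x + cornerUnit k)) :
    phantomLaplacian P β v x ≤ 0 := by
  rw [phantomLaplacian_eq_latticeLaplacian_add]
  have : ∑ k ∈ P x, ((1 - phantomWeight) * v x + phantomWeight * β - v (x + cornerUnit k)) ≤ 0 :=
    Finset.sum_nonpos fun k hk => by linarith [hph k hk]
  linarith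

/-- **Subsolution criterion.** If `Δ v (x) ≥ 0` and `v (x + e_k) ≤ (1 - w) v x + w β` in every phantom
direction, then `L_{P,β} v (x) ≥ 0`. [folklore] -/
theorem phantomLaplacian_nonneg_of {β : ℝ} {v : Site 2 → ℝ} {x : Site 2} (hΔ : 0 ≤ latticeLaplacian v x)
    (hph : ∀ k ∈ P x, v (x + cornerUnit k) ≤ (1 - phantomWeight) * v x + phantomWeight * β) :
    0 ≤ phantomLaplacian P β v x := by
  rw [phantomLaplacian_eq_latticeLaplacian_add]
  have : 0 ≤ ∑ k ∈ P x, ((1 - phantomWeight) * v x + phantomWeight * β - v (x + cornerUnit k)) :=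
    Finset.sum_nonneg fun k hk => by linarith [hph k hk]
  linarith

/-! ### The non-phantom outer boundary and the maximum principle with killing -/

/-- The **non-phantom outer boundary** of `S` for the phantom directions `P`: the sites `v + e_k`
outside `S` reached from a site `v ∈ S` in a non-phantom direction `k ∉ P v` — the sites whose
values enter `L_{P,β}` on `S` as boundary data. [folklore] -/
def phantomOuterBoundary (P : Site 2 → Finset (Fin 4)) (S : Set (Site 2)) : Set (Site 2) :=
  {x | x ∉ S ∧ ∃ v ∈ S, ∃ k : Fin 4, k ∉ P v ∧ x = v + cornerUnit k}

variable {S : Set (Site 2)}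

/-- The non-phantom outer boundary is part of the outer boundary. [folklore] -/
theorem phantomOuterBoundary_subset : phantomOuterBoundary P S ⊆ latticeOuterBoundary S := by
  rintro x ⟨hx, v, hv, k, -, rfl⟩
  exact ⟨hx, v, hv, k, rfl⟩

/-- A non-phantom neighbour of a site of `S` lies in `S` or in the non-phantom outer boundary. [folklore] -/
theorem add_cornerUnit_mem_union_phantomOuterBoundary {v : Site 2} (hv : v ∈ S) {k : Fin 4} (hk : k ∉ P v) :
    v + cornerUnit k ∈ S ∪ phantomOuterBoundary P S := by
  by_cases h : v + cornerUnit k ∈ S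
  · exact Or.inl h
  · exact Or.inr ⟨h, v, hv, k, hk, rfl⟩

/-- The non-phantom outer boundary of a finite set is finite. [folklore] -/
theorem phantomOuterBoundary_finite (hS : S.Finite) : (phantomOuterBoundary P S).Finite :=
  (latticeOuterBoundary_finite hS).subset phantomOuterBoundary_subset

/-- **Mean value step at a positive maximum.** If `L_{P,0} g (v) ≥ 0`, `g v = M' > 0` and
`g ≤ M'` at the non-phantom neighbours of `v`, then `v` has no phantom direction and all four
neighbours carry the value `M'`. [folklore] -/
theorem eq_of_phantomLaplacian_nonneg {g : Site 2 → ℝ} {v : Site 2} {M' : ℝ} (hM' : 0 < M')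
    (hL : 0 ≤ phantomLaplacian P 0 g v) (hv : g v = M')
    (hle : ∀ k : Fin 4, k ∉ P v → g (v + cornerUnit k) ≤ M') :
    P v = ∅ ∧ ∀ k : Fin 4, g (v + cornerUnit k) = M' := by
  have hterms : ∀ k ∈ univ.filter (fun k => k ∉ P v), g (v + cornerUnit k) - g v ≤ 0 := fun k hk => by
    rw [Finset.mem_filter] at hk
    rw [hv]
    linarith [hle k hk.2]
  have hsum : ∑ k ∈ univ.filter (fun k => k ∉ P v), (g (v + cornerUnit k) - g v) ≤ 0 := Finset.sum_nonpos hterms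
  have hB : phantomWeight * ((P v).card : ℝ) * (0 - g v) = -(phantomWeight * ((P v).card : ℝ) * M') := by
    rw [hv]; ring
  have hprod : 0 ≤ phantomWeight * ((P v).card : ℝ) * M' :=
    mul_nonneg (mul_nonneg phantomWeight_pos.le (Nat.cast_nonneg _)) hM'.le
  rw [phantomLaplacian, hB] at hL
  have hsum0 : ∑ k ∈ univ.filter (fun k => k ∉ P v), (g (v + cornerUnit k) - g v) = 0 :=
    le_antisymm hsum (by linarith)
  have hprod0 : phantomWeight * ((P v).card : ℝ) * M' = 0 := by linarith
  have hPv : P v = ∅ := by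
    rcases mul_eq_zero.1 hprod0 with h2 | h2
    · rcases mul_eq_zero.1 h2 with h3 | h3
      · exact absurd h3 phantomWeight_pos.ne'
      · exact Finset.card_eq_zero.1 (Nat.cast_eq_zero.1 h3)
    · exact absurd h2 hM'.ne'
  refine ⟨hPv, fun k => ?_⟩
  have hk : k ∈ univ.filter (fun k => k ∉ P v) := by
    rw [Finset.mem_filter, hPv]; exact ⟨Finset.mem_univ _, Finset.notMem_empty _⟩
  have h0 := (Finset.sum_eq_zero_iff_of_nonpos hterms).1 hsum0 k hk
  linarith

/-- **The maximum principle with killing** (DCHN 2011, proof of Proposition 8: the primitive is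
compared with harmonic measures of the modified walks through sub/superharmonicity; Lawler–Limic
2010, §6.1). Let `S ⊆ ℤ²` be finite and `L_{P,0} g ≥ 0` on `S`. If `g ≤ M` on the non-phantom outer
boundary of `S`, with `M ≥ 0`, then `g ≤ M` on `S`. (A positive maximum cannot sit at a site with a
phantom direction, where the killing term is negative; at the other sites it propagates eastwards
until it leaves the finite set `S`.) [cite: DuminilCopinHonglerNolin2011, §3.1, proof of Proposition 8] -/
theorem phantom_le_of_forall_boundary_le (hS : S.Finite) {g : Site 2 → ℝ}
    (hL : ∀ v ∈ S, 0 ≤ phantomLaplacian P 0 g v) {M : ℝ} (hM : 0 ≤ M)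
    (hb : ∀ x ∈ phantomOuterBoundary P S, g x ≤ M) : ∀ v ∈ S, g v ≤ M := by
  intro v₁ hv₁
  by_contra hlt
  rw [not_le] at hlt
  set T := S ∪ phantomOuterBoundary P S with hT
  have hTfin : T.Finite := hS.union (phantomOuterBoundary_finite hS)
  obtain ⟨v₀, hv₀T, hmax⟩ := Set.exists_max_image T g hTfin ⟨v₁, Or.inl hv₁⟩
  set M' := g v₀ with hM'def
  have hMM' : M < M' := lt_of_lt_of_le hlt (hmax v₁ (Or.inl hv₁))
  have hM'pos : 0 < M' := lt_of_le_of_lt hM hMM'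
  have key : ∀ n : ℕ, (∀ m < n, v₀ + m • cornerUnit 0 ∈ S) →
      g (v₀ + n • cornerUnit 0) = M' ∧ v₀ + n • cornerUnit 0 ∈ T := by
    intro n
    induction n with
    | zero => intro; simp [hM'def, hv₀T]
    | succ n ih =>
      intro hn
      have hnS : v₀ + n • cornerUnit 0 ∈ S := hn n n.lt_succ_self
      have ih' := ih fun m hm => hn m (hm.trans n.lt_succ_self)
      have hstep : v₀ + (n + 1) • cornerUnit 0 = v₀ + n • cornerUnit 0 + cornerUnit 0 := by
        rw [succ_nsmul, add_assoc]
      rw [hstep]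
      have hnb : ∀ k : Fin 4, k ∉ P (v₀ + n • cornerUnit 0) → g (v₀ + n • cornerUnit 0 + cornerUnit k) ≤ M' :=
        fun k hk => hmax _ (add_cornerUnit_mem_union_phantomOuterBoundary hnS hk)
      obtain ⟨hP0, hall⟩ := eq_of_phantomLaplacian_nonneg hM'pos (hL _ hnS) ih'.1 hnb
      refine ⟨hall 0, ?_⟩
      have h0 : (0 : Fin 4) ∉ P (v₀ + n • cornerUnit 0) := by rw [hP0]; exact Finset.notMem_empty _
      exact add_cornerUnit_mem_union_phantomOuterBoundary hnS h0
  have hex : ∃ n : ℕ, v₀ + n • cornerUnit 0 ∉ S := by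
    by_contra hall
    simp only [not_exists, not_not] at hall
    refine hS.not_infinite (Set.infinite_of_injective_forall_mem (f := fun n : ℕ => v₀ + n • cornerUnit 0)
      (fun a b hab => ?_) hall)
    have h' := congrArg (fun x : Site 2 => x 0) hab
    simp only [add_nsmul_cornerUnit_zero_apply, add_right_inj, Nat.cast_inj] at h'
    exact h'
  classical
  let n := Nat.find hex
  have hn : v₀ + n • cornerUnit 0 ∉ S := Nat.find_spec hex
  have hlt' : ∀ m < n, v₀ + m • cornerUnit 0 ∈ S := fun m hm => by
    have := Nat.find_min hex hm
    simpa using this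
  obtain ⟨hgM', hnT⟩ := key n hlt'
  have hbdry : v₀ + n • cornerUnit 0 ∈ phantomOuterBoundary P S := hnT.resolve_left hn
  have := hb _ hbdry
  linarith

/-- **Comparison principle for the phantom Laplacian.** On a finite `S`: if `u` is an
`L_{P,β}`-subsolution, `v` an `L_{P,β}`-supersolution, and `u ≤ v` on the non-phantom outer boundary,
then `u ≤ v` on `S` (the phantom terms pull both towards the same level `β` and cancel in the
difference). [cite: DuminilCopinHonglerNolin2011, §3.1, proof of Proposition 8] -/
theorem phantom_le_of_sub_super (hS : S.Finite) {β : ℝ} {u v : Site 2 → ℝ}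
    (hu : ∀ x ∈ S, 0 ≤ phantomLaplacian P β u x) (hv : ∀ x ∈ S, phantomLaplacian P β v x ≤ 0)
    (hb : ∀ x ∈ phantomOuterBoundary P S, u x ≤ v x) : ∀ x ∈ S, u x ≤ v x := by
  have hL : ∀ x ∈ S, 0 ≤ phantomLaplacian P 0 (u - v) x := fun x hx => by
    rw [← phantomLaplacian_sub]
    linarith [hu x hx, hv x hx]
  intro x hx
  have := phantom_le_of_forall_boundary_le hS hL le_rfl (fun y hy => by
    rw [Pi.sub_apply]; linarith [hb y hy]) x hx
  rw [Pi.sub_apply] at this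
  linarith

/-- **Lower comparison**: an `L_{P,β}`-supersolution dominates on `S` every `L_{P,β}`-subsolution it
dominates on the non-phantom outer boundary (the same statement, read for lower bounds on the
superharmonic white primitive, DCHN Lemmas 9–10). [cite: DuminilCopinHonglerNolin2011, §3.1] -/
theorem phantom_ge_of_super_sub (hS : S.Finite) {β : ℝ} {u ψ : Site 2 → ℝ}
    (hu : ∀ x ∈ S, phantomLaplacian P β u x ≤ 0) (hψ : ∀ x ∈ S, 0 ≤ phantomLaplacian P β ψ x)
    (hb : ∀ x ∈ phantomOuterBoundary P S, ψ x ≤ u x) : ∀ x ∈ S, ψ x ≤ u x :=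
  phantom_le_of_sub_super hS hψ hu hb

/-! ### DCHN Lemma 11, first item: the distance barrier -/

section DistBarrier

variable (z : Site 2) (d : ℕ)

/-- The **distance barrier** around `z` at scale `d`: in coordinates `(X, Y) = v - z`,
`b(v) = (X² - Y² + 2d(Y + 2)) / (d² + 4d)` — a lattice-harmonic quadratic polynomial equal to `1` on
the `ℓ¹`-sphere `|X| + Y = d`, nonnegative on `{Y ≥ -1, |X| + Y ≤ d}` and of size `4/(d+4)` at `z`.
It replaces the random-walk estimate behind DCHN's Lemma 11, first item ("as before, this harmonic
measure is easy to estimate"). [cite: DuminilCopinHonglerNolin2011, §3.2, Lemma 11] -/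
def distBarrier (v : Site 2) : ℝ :=
  (((v 0 - z 0 : ℤ) : ℝ) ^ 2 - ((v 1 - z 1 : ℤ) : ℝ) ^ 2 + 2 * (d : ℝ) * (((v 1 - z 1 : ℤ) : ℝ) + 2)) /
    ((d : ℝ) ^ 2 + 4 * d)

/-- The numerator of the distance barrier. [folklore] -/
def distBarrierNum (v : Site 2) : ℝ :=
  ((v 0 - z 0 : ℤ) : ℝ) ^ 2 - ((v 1 - z 1 : ℤ) : ℝ) ^ 2 + 2 * (d : ℝ) * (((v 1 - z 1 : ℤ) : ℝ) + 2)

variable {z d}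

/-- The barrier is its numerator over `d² + 4d`. [folklore] -/
theorem distBarrier_eq_num_div (v : Site 2) :
    distBarrier z d v = distBarrierNum z d v / ((d : ℝ) ^ 2 + 4 * d) := rfl

/-- The numerator is lattice-harmonic on all of `ℤ²` (`Δ X² = 2 = Δ Y²`, affine functions are
harmonic). [folklore] -/
theorem latticeLaplacian_distBarrierNum (v : Site 2) : latticeLaplacian (distBarrierNum z d) v = 0 := by
  rw [latticeLaplacian, Fin.sum_univ_four]
  have c0 : (v + cornerUnit 0) 0 = v 0 + 1 ∧ (v + cornerUnit 0) 1 = v 1 := by simp [cornerUnit]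
  have c1 : (v + cornerUnit 1) 0 = v 0 ∧ (v + cornerUnit 1) 1 = v 1 + 1 := by simp [cornerUnit]
  have c2 : (v + cornerUnit 2) 0 = v 0 - 1 ∧ (v + cornerUnit 2) 1 = v 1 := by simp [cornerUnit, sub_eq_add_neg]
  have c3 : (v + cornerUnit 3) 0 = v 0 ∧ (v + cornerUnit 3) 1 = v 1 - 1 := by simp [cornerUnit, sub_eq_add_neg]
  simp only [distBarrierNum, c0.1, c0.2, c1.1, c1.2, c2.1, c2.2, c3.1, c3.2]
  push_cast
  ring

/-- The barrier is a constant multiple of its numerator. [folklore] -/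
theorem distBarrier_eq_const_mul :
    distBarrier z d = fun v => (1 / ((d : ℝ) ^ 2 + 4 * d)) * distBarrierNum z d v := by
  funext v
  rw [distBarrier_eq_num_div]
  ring

/-- The distance barrier is lattice-harmonic on all of `ℤ²`. [folklore] -/
theorem latticeLaplacian_distBarrier (v : Site 2) : latticeLaplacian (distBarrier z d) v = 0 := by
  rw [distBarrier_eq_const_mul, latticeLaplacian_const_mul, latticeLaplacian_distBarrierNum, mul_zero]

/-- On the `ℓ¹`-sphere `|X| + Y = d` the barrier equals `1`. [folklore] -/
theorem distBarrier_eq_one_of_sphere (hd : 1 ≤ d) {v : Site 2} (hv : |v 0 - z 0| + (v 1 - z 1) = d) :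
    distBarrier z d v = 1 := by
  have hD : (0 : ℝ) < (d : ℝ) ^ 2 + 4 * d := by
    have : (1 : ℝ) ≤ d := by exact_mod_cast hd
    positivity
  rw [distBarrier, div_eq_one_iff_eq hD.ne']
  have habs : ((|v 0 - z 0| : ℤ) : ℝ) ^ 2 = ((v 0 - z 0 : ℤ) : ℝ) ^ 2 := by
    push_cast; exact sq_abs _
  have hv' : ((|v 0 - z 0| : ℤ) : ℝ) = (d : ℝ) - ((v 1 - z 1 : ℤ) : ℝ) := by
    have := congrArg (fun t : ℤ => (t : ℝ)) hv
    push_cast at this ⊢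
    linarith
  rw [← habs, hv']
  ring

/-- The numerator is at least `4d` on `{Y ≥ 0, |X| + Y ≤ d}` (as `Y(2d - Y) ≥ 0`). [folklore] -/
theorem four_mul_le_distBarrierNum {v : Site 2} (hY : 0 ≤ v 1 - z 1) (hv : |v 0 - z 0| + (v 1 - z 1) ≤ d) :
    4 * (d : ℝ) ≤ distBarrierNum z d v := by
  rw [distBarrierNum]
  have hY' : (0 : ℝ) ≤ ((v 1 - z 1 : ℤ) : ℝ) := by exact_mod_cast hY
  have hYd : ((v 1 - z 1 : ℤ) : ℝ) ≤ d := by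
    have h1 : v 1 - z 1 ≤ d := le_trans (by linarith [abs_nonneg (v 0 - z 0)]) hv
    exact_mod_cast h1
  nlinarith [sq_nonneg (((v 0 - z 0 : ℤ) : ℝ))]

/-- Along a lattice edge from a site with `Y ≥ 0`, `|X| + Y ≤ d - 1` the numerator drops by at most
`2d + 1`. [folklore] -/
theorem distBarrierNum_sub_le_neighbour {v : Site 2} (hY : 0 ≤ v 1 - z 1)
    (hv : |v 0 - z 0| + (v 1 - z 1) + 1 ≤ d) (k : Fin 4) :
    distBarrierNum z d v - (2 * d + 1) ≤ distBarrierNum z d (v + cornerUnit k) := by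
  have hc : ∀ k : Fin 4,
      ((v + cornerUnit k) 0 = v 0 + 1 ∧ (v + cornerUnit k) 1 = v 1) ∨
      ((v + cornerUnit k) 0 = v 0 ∧ (v + cornerUnit k) 1 = v 1 + 1) ∨
      ((v + cornerUnit k) 0 = v 0 - 1 ∧ (v + cornerUnit k) 1 = v 1) ∨
      ((v + cornerUnit k) 0 = v 0 ∧ (v + cornerUnit k) 1 = v 1 - 1) := by
    intro k
    fin_cases k <;> simp [cornerUnit, sub_eq_add_neg]
  have hX : |((v 0 : ℤ) : ℝ) - (z 0 : ℝ)| + 1 ≤ d := by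
    have h1 : |v 0 - z 0| + 1 ≤ (d : ℤ) := by linarith
    have h2 := (Int.cast_le (R := ℝ)).2 h1
    push_cast at h2
    exact h2
  have hXle : ((v 0 : ℤ) : ℝ) - (z 0 : ℝ) ≤ |((v 0 : ℤ) : ℝ) - (z 0 : ℝ)| := le_abs_self _
  have hXge : -|((v 0 : ℤ) : ℝ) - (z 0 : ℝ)| ≤ ((v 0 : ℤ) : ℝ) - (z 0 : ℝ) := neg_abs_le _
  have hY' : (0 : ℝ) ≤ ((v 1 : ℤ) : ℝ) - (z 1 : ℝ) := by
    have h2 := (Int.cast_le (R := ℝ)).2 hY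
    push_cast at h2
    linarith
  have hYd : ((v 1 : ℤ) : ℝ) - (z 1 : ℝ) + 1 ≤ d := by
    have h1 : v 1 - z 1 + 1 ≤ (d : ℤ) := by linarith [abs_nonneg (v 0 - z 0)]
    have h2 := (Int.cast_le (R := ℝ)).2 h1
    push_cast at h2
    exact h2
  rcases hc k with ⟨h0, h1⟩ | ⟨h0, h1⟩ | ⟨h0, h1⟩ | ⟨h0, h1⟩ <;> simp only [distBarrierNum, h0, h1] <;>
    push_cast <;> nlinarith [hXle, hXge, hY', hYd, hX]

/-- **One-step ratio bound.** For `v` with `Y ≥ 0`, `|X| + Y ≤ d - 1` and any lattice neighbour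
`v + e_k`: `b(v + e_k) ≥ (1 - w) b(v)`. (The numerator changes by at least `-(2d+1)` along an edge,
while `w · numerator ≥ (3/4) · 4d = 3d ≥ 2d + 1`; this is where `w ≥ 3/4` is used.) [folklore] -/
theorem distBarrier_neighbour_ge (hd : 1 ≤ d) {v : Site 2} (hY : 0 ≤ v 1 - z 1)
    (hv : |v 0 - z 0| + (v 1 - z 1) + 1 ≤ d) (k : Fin 4) :
    (1 - phantomWeight) * distBarrier z d v ≤ distBarrier z d (v + cornerUnit k) := by
  have hd' : (1 : ℝ) ≤ d := by exact_mod_cast hd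
  have hD : (0 : ℝ) < (d : ℝ) ^ 2 + 4 * d := by positivity
  rw [distBarrier_eq_num_div, distBarrier_eq_num_div, ← mul_div_assoc, div_le_div_iff_of_pos_right hD]
  have hnum := four_mul_le_distBarrierNum hY (by linarith : |v 0 - z 0| + (v 1 - z 1) ≤ d)
  have hw := three_quarters_le_phantomWeight
  have hdiff := distBarrierNum_sub_le_neighbour hY hv k
  nlinarith [mul_nonneg (sub_nonneg.2 hw) (sub_nonneg.2 hnum)]

/-- The barrier is nonnegative at every neighbour of a site of `{Y ≥ 0, |X| + Y ≤ d - 1}`. [folklore] -/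
theorem distBarrier_neighbour_nonneg (hd : 1 ≤ d) {v : Site 2} (hY : 0 ≤ v 1 - z 1)
    (hv : |v 0 - z 0| + (v 1 - z 1) + 1 ≤ d) (k : Fin 4) : 0 ≤ distBarrier z d (v + cornerUnit k) := by
  refine le_trans ?_ (distBarrier_neighbour_ge hd hY hv k)
  have hd' : (1 : ℝ) ≤ d := by exact_mod_cast hd
  have hD : (0 : ℝ) < (d : ℝ) ^ 2 + 4 * d := by positivity
  have hnum := four_mul_le_distBarrierNum hY (by linarith : |v 0 - z 0| + (v 1 - z 1) ≤ d)
  have hb : 0 ≤ distBarrier z d v := by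
    rw [distBarrier_eq_num_div]; exact div_nonneg (by linarith) hD.le
  exact mul_nonneg one_sub_phantomWeight_nonneg hb

/-- The value of the barrier at its centre: `b(z) = 4/(d + 4)`. [folklore] -/
theorem distBarrier_self (hd : 1 ≤ d) : distBarrier z d z = 4 / ((d : ℝ) + 4) := by
  have hd' : (1 : ℝ) ≤ d := by exact_mod_cast hd
  rw [distBarrier]
  simp only [sub_self, Int.cast_zero]
  rw [div_eq_div_iff (by positivity) (by positivity)]
  ring

/-- **The distance barrier is an `L_{P,0}`-supersolution** on `{Y ≥ 0, |X| + Y ≤ d - 1}`, for every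
assignment of phantom directions. [cite: DuminilCopinHonglerNolin2011, §3.2, Lemma 11] -/
theorem phantomLaplacian_distBarrier_nonpos (hd : 1 ≤ d) {v : Site 2} (hY : 0 ≤ v 1 - z 1)
    (hv : |v 0 - z 0| + (v 1 - z 1) + 1 ≤ d) : phantomLaplacian P 0 (distBarrier z d) v ≤ 0 := by
  refine phantomLaplacian_nonpos_of (latticeLaplacian_distBarrier v).le fun k _ => ?_
  rw [mul_zero, add_zero]
  exact distBarrier_neighbour_ge hd hY hv k

/-- **DCHN Lemma 11, first item, barrier form.** Let `z ∈ ℤ²`, `d ≥ 1`, `S` a finite set of sites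
with `Y ≥ 0` and `|X| + Y ≤ d - 1` in coordinates relative to `z`, `P` any phantom directions and
`u` an `L_{P,0}`-subsolution on `S` such that at every non-phantom outer-boundary point either
`u ≤ 0`, or `u ≤ 1` and the point lies on the `ℓ¹`-sphere `|X| + Y = d`. Then `u ≤ distBarrier z d`
on `S`. (For the black primitive `H_B - Hw` of a Dobrushin domain above the row of `z` this says: if
the wired arc is at `ℓ¹`-distance `≥ d` from `z`, the primitive is below the barrier.)
[cite: DuminilCopinHonglerNolin2011, §3.2, Lemma 11, first item] -/
theorem phantom_sub_le_distBarrier (hd : 1 ≤ d) (hS : S.Finite)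
    (hSsub : ∀ v ∈ S, 0 ≤ v 1 - z 1 ∧ |v 0 - z 0| + (v 1 - z 1) + 1 ≤ d) {u : Site 2 → ℝ}
    (hu : ∀ v ∈ S, 0 ≤ phantomLaplacian P 0 u v)
    (hb : ∀ x ∈ phantomOuterBoundary P S, u x ≤ 0 ∨ (u x ≤ 1 ∧ |x 0 - z 0| + (x 1 - z 1) = d)) :
    ∀ v ∈ S, u v ≤ distBarrier z d v := by
  refine phantom_le_of_sub_super hS hu (fun v hv => phantomLaplacian_distBarrier_nonpos hd (hSsub v hv).1 (hSsub v hv).2)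
    fun x hx => ?_
  rcases hb x hx with h0 | ⟨h1, hsph⟩
  · obtain ⟨-, v, hv, k, -, rfl⟩ := hx
    exact h0.trans (distBarrier_neighbour_nonneg hd (hSsub v hv).1 (hSsub v hv).2 k)
  · rw [distBarrier_eq_one_of_sphere hd hsph]; exact h1

/-- **DCHN Lemma 11, first item** (`Hb(B_0) ≤ c₃ / d₁(0)`, here with `c₃ = 4`): under the hypotheses
of `phantom_sub_le_distBarrier`, if `z ∈ S` then `u z ≤ 4/(d + 4)`. In DCHN's words: the harmonic
measure of the wired arc, for the modified walk on the black faces of a Dobrushin `ℍ`-domain started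
at the boundary point `0`, is at most `c₃/d₁(0)`, `d₁(0)` the distance from `0` to the wired arc; by
the maximum principle the same bound holds for every subsolution with these boundary values, which
is the form in which it is applied to the primitive of the observable (their Proposition 8).
[cite: DuminilCopinHonglerNolin2011, §3.2, Lemma 11, first item] -/
theorem dchn_lemma11_dist (hd : 1 ≤ d) (hS : S.Finite)
    (hSsub : ∀ v ∈ S, 0 ≤ v 1 - z 1 ∧ |v 0 - z 0| + (v 1 - z 1) + 1 ≤ d) {u : Site 2 → ℝ}
    (hu : ∀ v ∈ S, 0 ≤ phantomLaplacian P 0 u v)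
    (hb : ∀ x ∈ phantomOuterBoundary P S, u x ≤ 0 ∨ (u x ≤ 1 ∧ |x 0 - z 0| + (x 1 - z 1) = d))
    (hz : z ∈ S) : u z ≤ 4 / ((d : ℝ) + 4) := by
  rw [← distBarrier_self hd]
  exact phantom_sub_le_distBarrier hd hS hSsub hu hb z hz

/-- The bound of `dchn_lemma11_dist` in the form `u z ≤ 4/d`. [cite: DuminilCopinHonglerNolin2011, §3.2, Lemma 11] -/
theorem dchn_lemma11_dist' (hd : 1 ≤ d) (hS : S.Finite)
    (hSsub : ∀ v ∈ S, 0 ≤ v 1 - z 1 ∧ |v 0 - z 0| + (v 1 - z 1) + 1 ≤ d) {u : Site 2 → ℝ}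
    (hu : ∀ v ∈ S, 0 ≤ phantomLaplacian P 0 u v)
    (hb : ∀ x ∈ phantomOuterBoundary P S, u x ≤ 0 ∨ (u x ≤ 1 ∧ |x 0 - z 0| + (x 1 - z 1) = d))
    (hz : z ∈ S) : u z ≤ 4 / (d : ℝ) := by
  refine (dchn_lemma11_dist hd hS hSsub hu hb hz).trans ?_
  have hd' : (1 : ℝ) ≤ d := by exact_mod_cast hd
  exact div_le_div_of_nonneg_left (by norm_num) (by positivity) (by linarith)

end DistBarrier

end Literature.Probability.LatticeModels
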